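import Literature.AnabelianGeometry.AbsoluteAnabelian.LocalVolumesArchimedean
import Literature.IUT.LogThetaLattice.PacketLogVolumes
import HarnessLib

/-!
# [IUTchIII] Remark 3.9.2 at the ARCHIMEDEAN local model: the «nonnegative elements» recovered from the radial
# log-volume are exactly `{‖f‖ ≤ 1}` (proof-only; archimedean sibling of `PacketLogVolumesRemark392Local.lean`)

S. Mochizuki, *Inter-universal Teichmüller theory III*, kurims manuscript (May 2020), Remark 3.9.2, p. 119
[claim: Mochizuki2012, status: disputed]: the submonoid of «nonnegative elements» of the subquotient of
`(†𝕄⊛_mod)_α` at `w ∈ 𝕍` is recovered "by considering the effect of multiplication by elements of `(†𝕄⊛_mod)_α` on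
the log-volumes"; abc-iut-L6-t4's typed form `Remark392_nonnegAt act vol := {f | ∀ S, vol (act f S) ≤ vol S}`
(`PacketLogVolumes.lean`, p404053). At an ARCHIMEDEAN place the log-volume of Prop. 3.9 (i) is the RADIAL
log-volume ([AbsTopIII] Prop. 5.7 (ii): abc-iut-L4-t3's `ComplexVolume.radialLogVolume`, `radialVolume (x • A) =
‖x‖ · radialVolume A`). RESULT (plan/L6/SUBDAG-IUTchIII-Prop-39.md, Remarks; seat abc-iut-w5-d178):
**`remark392_nonnegAt_arch`** — `Remark392_nonnegAt (·•·) radialLogVolume = {f : ℂˣ | ‖f‖ ≤ 1}`; with the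
nonarchimedean sibling `remark392_nonnegAt_localField` this says, at every place of the model, that the printed
recovery returns exactly the elements of absolute value `≤ 1`. Sets of zero or infinite radial volume carry
`Real.log`'s junk value `0` on both sides (harmless; the unit disc detects `‖f‖ > 1`).
Classical; no new definitions; nothing here bears on the disputed [IUTchIII] Cor. 3.12.
[cite: MochizukiAbsTopIII2015, Prop. 5.7 (ii) p. 138]
-/

noncomputable section

namespace Literature.IUT.LogThetaLattice

open MeasureTheory Set Metric
open scoped Pointwise
open Literature.AnabelianGeometry.AbsoluteAnabelian
open Literature.AnabelianGeometry.AbsoluteAnabelian.ComplexVolume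

/-- If `‖f‖ ≤ 1`, multiplication by `f ∈ ℂ^×` never increases the radial log-volume — on EVERY subset
(`μ_k(f·S) = ‖f‖ · μ_k(S)`). [cite: MochizukiAbsTopIII2015, Prop. 5.7 (ii) p. 138] -/
theorem radialLogVolume_units_smul_le (f : ℂˣ) (hf : ‖(f : ℂ)‖ ≤ 1) (S : Set ℂ) :
    radialLogVolume ((f : ℂ) • S) ≤ radialLogVolume S := by
  have hf0 : 0 < ‖(f : ℂ)‖ := norm_pos_iff.mpr f.ne_zero
  unfold radialLogVolume
  rw [radialVolume_smul]
  by_cases hS : radialVolume S = 0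
  · rw [hS, mul_zero]
  · have hSnn : 0 ≤ radialVolume S := ENNReal.toReal_nonneg
    have hSpos : 0 < radialVolume S := lt_of_le_of_ne hSnn (Ne.symm hS)
    rw [Real.log_mul hf0.ne' hS]
    have : Real.log ‖(f : ℂ)‖ ≤ 0 := Real.log_nonpos hf0.le hf
    linarith

/-- If `‖f‖ > 1`, multiplication by `f` strictly increases the radial log-volume of the unit disc
(`μ_k(𝒪_k) = 1`, `μ_k(f·𝒪_k) = ‖f‖`). [cite: MochizukiAbsTopIII2015, Prop. 5.7 (ii) p. 138] -/
theorem radialLogVolume_unitDisc_lt_of_one_lt_norm (f : ℂˣ) (hf : 1 < ‖(f : ℂ)‖) :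
    radialLogVolume (closedBall (0 : ℂ) 1) < radialLogVolume ((f : ℂ) • closedBall (0 : ℂ) 1) := by
  unfold radialLogVolume
  rw [radialVolume_smul, radialVolume_closedBall_one, mul_one, Real.log_one]
  exact Real.log_pos hf

/-- **[IUTchIII] Remark 3.9.2 at the archimedean model.** With the container `ℂ`, the action `f ↦ (S ↦ f·S)` of
`f ∈ ℂ^×` and the radial log-volume, abc-iut-L6-t4's recovered set of «nonnegative elements» is `{f | ‖f‖ ≤ 1}`.
[claim: Mochizuki2012, status: disputed] -/
theorem remark392_nonnegAt_arch :
    Remark392_nonnegAt (fun (f : ℂˣ) (S : Set ℂ) => (f : ℂ) • S) radialLogVolume = {f : ℂˣ | ‖(f : ℂ)‖ ≤ 1} := by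
  ext f
  simp only [Remark392_nonnegAt, Set.mem_setOf_eq]
  constructor
  · intro h
    by_contra hlt
    exact absurd (h (closedBall (0 : ℂ) 1))
      (not_le.mpr (radialLogVolume_unitDisc_lt_of_one_lt_norm f (not_le.mp hlt)))
  · intro hf S
    exact radialLogVolume_units_smul_le f hf S

end Literature.IUT.LogThetaLattice

end
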